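import Summits.AtomisticToContinuum.HydrodynamicLimit.Theorems.AntiMazurCoboundariesCellForecastPressureDecayKinematicAssembly
import Summits.AtomisticToContinuum.HydrodynamicLimit.Theorems.AntiMazurCoboundariesCellForecastPressureDecayClusterTailNonFresh
import Summits.AtomisticToContinuum.HydrodynamicLimit.Theorems.AntiMazurCoboundariesCellForecastPressureDecayClusterTailFreshPairHit
import Summits.AtomisticToContinuum.HydrodynamicLimit.Theorems.AntiMazurCoboundariesCellForecastPressureDecayClusterTailDoubleCylinder
import Summits.AtomisticToContinuum.HydrodynamicLimit.Theorems.AntiMazurCoboundariesCellForecastPressureDecayClusterTailAssembly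
import Summits.AtomisticToContinuum.HydrodynamicLimit.Theorems.AntiMazurCoboundariesCellForecastPressureDecayContactStatistics
import HarnessLib

/-!
# Line `enskog-compensator-martingale` — skeleton v4 for the crux `CellForecastPressureDecay`
(stmt-AtomisticToContinuum-13915, route AntiMazurCoboundaries, rank 6: the N-free core)

Continuation lead `prover-line-stmt-AtomisticToContinuum-13915-c3-0` (2026-08-16), after the planner's checked
skeleton `Lines/enskog-compensator-martingale.lean` (crux-plan seat) and lead c2's skeleton v2/v3 (objects modules
`Theorems/AntiMazurCoboundariesCellForecastPressureDecayEnskogObjects{,B}.lean`, p98997 / p119889). All objects and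
obligation Props (`cellLaw`, `fvel`, `compensated`, `Orthogonal`, `pairKernel`, `CellLawFactorises`,
`ContactLayerBounds`, `ContactStatistics`, `ClusterTail`, `KinematicRates`, `WindowL2Rate`, `TiltStability`) are
IMPORTED from the landed objects modules; nothing is re-declared here.

## State of the line at v4 (2026-08-17, after the lead's wave 1)

S2 IS CLOSED: `KinematicRates σ` holds UNCONDITIONALLY for `0 < σ < 3/16` (`kinematicRates_holds`,
`Theorems/AntiMazurCoboundariesCellForecastPressureDecayKinematicRates.lean`), assembled from the landed statics S2a
`stub_cellLawFactorises` (p102145), S2b `stub_contactLayerBounds` (p112420), S2c `stub_contactStatistics` (p125100), the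
short-time cluster tail S2e `stub_clusterTail` (p135118; sub-goals `stub_clusterTail_{firstOrder,nonFresh,freshPairHit,
doubleCylinder,assembly}` p130629/p133822/p134519/p128654/p132645 — a Lanford-type short-time estimate at fixed σ for the
free-boundary canonical cell, without a cluster expansion) and the kinematic assembly S2d′ `stub_kinematicAssemblyOfTail`
(p134971; pieces p130178/p130199/p133995/p133951/p134295 and lead c2's eight pieces p113574–p119784).

OPEN (registered stubs of this skeleton; `sorry` only inside them) — the line's open core:
* `stub_poissonCorrector` (S1) — a BOUNDED continuous pre-image under `L = hardSphereLinearizedOp`: reduced (p120828,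
  p129073 `stub_poissonCorrector_of_boundedModInvariants`) to the borderline-weight asymptotics of the M-orthogonal inverse
  (`ψ₀ = c|v|² + ⟪e,v⟩ + a + O(1)`; indicial roots β = 2, 1 of `4∫₀¹P_l(c)c^{β+1}dc = 1`, none with Re β ≥ 0 for l ≥ 2);
  the tree PROVES the orthogonal inverse unbounded (`LinearizedBoltzmannOrthogonalInverseUnbounded`) and has it only with
  growth `(1+|v|²)²` / `e^{θ|v|²}`; no absorption scheme exists at constant weight (gain factor exactly 2) — the missing
  theorem "BorderlineChapmanEnskogInverse" is new analysis (Funk–Hecke + Mellin), size L–XL, not in print.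
* `stub_windowL2Rate` (S3) — the centred L² crux with rate `L³/T`: ≡ the open item stmt-AtomisticToContinuum-10952
  (FastObservableMeanErgodic) WITH a rate; missing estimate: `Σ_{i,j} ∫₀ᵀ∫₀ᵀ Cov_P(g(ṽ_i(t)), g(ṽ_j(s))) ds dt ≤ C L³ T`
  uniformly in `n/L³ ≤ 2` (time-integrable, density-uniform decay of the collective autocorrelation of `g` at fixed σ).
* `stub_tiltStability` (S4 = C⁺, lead-held) — one-slab tilt stability of the compensated process; ⊋ crux (rate `1/T`);
  the open content of the crux in compensator currency (all orders under the compensated-past tilt).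

COMPOSITION (kernel-checked below): `CellForecastPressureDecay_of` concludes the crux BY NAME from S1, S3, S4 and the
THEOREM `kinematicRates_holds`.
-/

noncomputable section

open MeasureTheory ProbabilityTheory Set Filter
open scoped ENNReal BigOperators InnerProductSpace
open Literature.Analysis.FluidPDE Literature.MathematicalPhysics.KineticTheory
open Literature.Analysis.UnboundedOperators (hardSphereLinearizedOp)
open Summit.AtomisticToContinuum.HydrodynamicLimit.Theorems.CellForecastPressureDecay
  (cellRef isProbabilityMeasure_cellLaw vel_localClusterState_of_card_le_one)
open Summit.AtomisticToContinuum.HydrodynamicLimit.Theorems.EnskogCompensator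

namespace Summit.AtomisticToContinuum.HydrodynamicLimit.Cruxes.CellForecastPressureDecay.EnskogCompensatorMartingale

open Summit.AtomisticToContinuum.HydrodynamicLimit.Theses.AntiMazurCoboundaries (CellForecastPressureDecay)

/-! ## § 1 The stubs (registered obligations of the line; `sorry` only here) -/

/-- **S1 · bounded Poisson corrector**: every bounded continuous `g ⊥ span{1, v, |v|²}` has a bounded continuous
pre-image `w` under the in-tree linearised hard-sphere operator, `L w = g` pointwise, `‖w‖∞ ≤ C₀ ‖g‖∞`. Reduced
(p120828, `stub_poissonCorrector_of_exists`) to the existence, for each such `g`, of SOME bounded measurable pointwise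
solution; the `M`-orthogonal solution does not qualify (`exists_unbounded_orthogonal_inverse_hardSphereLinearizedOp`).
Same statement as `stub_chapmanEnskogInverse` of crux 10967's dynkin-azuma line. -/
theorem stub_poissonCorrector :
    ∃ C₀ : ℝ, 0 < C₀ ∧ ∀ (g : V3 → ℝ) (b : ℝ), Continuous g → (∀ v, |g v| ≤ b) → Orthogonal g →
      ∃ w : V3 → ℝ, Continuous w ∧ (∀ v, |w v| ≤ C₀ * b) ∧ hardSphereLinearizedOp w = g := by
  sorry

/-- **S3 · the centred L² crux with rate** (`k = 2` sum rule): given exact equal-time kinematics, the window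
variance is `O(L³/T)`. Open at fixed `σ` (the cell twin of stmt-10952 WITH a rate); strictly weaker than S4. -/
theorem stub_windowL2Rate :
    ∃ σ₀ : ℝ, 0 < σ₀ ∧ ∀ σ : ℝ, 0 < σ → σ < σ₀ → KinematicRates σ → WindowL2Rate σ := by
  sorry

/-- **S4 · THE BET (C⁺) · one-slab tilt-stability of the compensated collision process** (lead-held, the open
content of the line; stronger than the crux — it yields the rate `1/T`). -/
theorem stub_tiltStability :
    ∃ σ₀ : ℝ, 0 < σ₀ ∧ ∀ σ : ℝ, 0 < σ → σ < σ₀ →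
      KinematicRates σ → WindowL2Rate σ → TiltStability σ := by
  sorry

/-! ## § 2 `KinematicRates σ` is a theorem (S2 closed) -/

/-- **S2 closed**: `KinematicRates σ` for all `0 < σ < σ₀` — the same ten-line assembly as the landed
`kinematicRates_holds` (`Theorems/AntiMazurCoboundariesCellForecastPressureDecayKinematicRates.lean`), from the LANDED
statics S2a/S2b/S2c, cluster-tail sub-goals S2e and kinematic assembly S2d′; no `sorry` in its cone. -/
theorem kinematicRates_of_stubs :
    ∃ σ₀ : ℝ, 0 < σ₀ ∧ ∀ σ : ℝ, 0 < σ → σ < σ₀ → KinematicRates σ := by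
  obtain ⟨σ₁, hσ₁, hA⟩ := stub_kinematicAssemblyOfTail
  refine ⟨min σ₁ (3 / 16), by positivity, fun σ hσ hσlt => ?_⟩
  have h1 : σ < σ₁ := hσlt.trans_le (min_le_left _ _)
  have h316 : σ ≤ 3 / 16 := (hσlt.trans_le (min_le_right _ _)).le
  have hfac : CellLawFactorises σ := stub_cellLawFactorises σ
  have hclb : ContactLayerBounds σ := stub_contactLayerBounds σ hσ h316 hfac
  have hct : ClusterTail σ :=
    stub_clusterTail_assembly σ hσ h316 (stub_clusterTail_nonFresh σ hσ h316 hfac)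
      (stub_clusterTail_freshPairHit σ hσ h316 hfac) (stub_clusterTail_doubleCylinder σ hσ h316 hfac)
  exact hA σ hσ h1 hfac hclb (stub_contactStatistics σ hσ h316 hfac hclb) hct

/-! ## § 3 Composition: the stubs imply the crux (kernel-checked; no `sorry` from here on) -/

section Composition

/-- Slab iteration: a multiplicative one-slab bound for all slab lengths `≤ Δ` integrates to
`E e^{M_T} ≤ e^{aT}` from `M_0 ≡ 0` (tile `[0,T]` by `⌈T/Δ⌉` equal slabs). -/
theorem iterate_slabs {α : Type*} [MeasurableSpace α] (μ : Measure α) [IsProbabilityMeasure μ]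
    (M : ℝ → α → ℝ) (hM0 : ∀ z, M 0 z = 0) {a Δ T : ℝ} (hΔ : 0 < Δ) (hT : 0 < T)
    (hstep : ∀ t Δ' : ℝ, 0 ≤ t → 0 < Δ' → Δ' ≤ Δ → t + Δ' ≤ T →
      ∫⁻ z, ENNReal.ofReal (Real.exp (M (t + Δ') z)) ∂μ ≤
        ENNReal.ofReal (Real.exp (a * Δ')) * ∫⁻ z, ENNReal.ofReal (Real.exp (M t z)) ∂μ) :
    ∫⁻ z, ENNReal.ofReal (Real.exp (M T z)) ∂μ ≤ ENNReal.ofReal (Real.exp (a * T)) := by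
  set m : ℕ := ⌈T / Δ⌉₊ with hm
  have hm1 : 1 ≤ m := Nat.one_le_ceil_iff.2 (div_pos hT hΔ)
  have hmpos : (0 : ℝ) < m := by exact_mod_cast hm1
  set D : ℝ := T / m with hD
  have hDpos : 0 < D := div_pos hT hmpos
  have hDΔ : D ≤ Δ := by
    rw [hD, div_le_iff₀ hmpos]
    have h1 : T / Δ ≤ m := Nat.le_ceil _
    rw [div_le_iff₀ hΔ] at h1
    linarith [mul_comm Δ (m : ℝ)]
  have hmD : (m : ℝ) * D = T := by
    rw [hD]; field_simp
  -- induction over the slabs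
  have key : ∀ k : ℕ, k ≤ m →
      ∫⁻ z, ENNReal.ofReal (Real.exp (M (k * D) z)) ∂μ ≤
        ENNReal.ofReal (Real.exp (a * D * k)) := by
    intro k
    induction k with
    | zero =>
      intro _
      simp [hM0]
    | succ k ih =>
      intro hk
      have hk' : k ≤ m := Nat.le_of_succ_le hk
      have hklt : (k : ℝ) + 1 ≤ m := by exact_mod_cast hk
      have ht0 : 0 ≤ (k : ℝ) * D := by positivity
      have htT : (k : ℝ) * D + D ≤ T := by
        calc (k : ℝ) * D + D = ((k : ℝ) + 1) * D := by ring
          _ ≤ m * D := by gcongr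
          _ = T := hmD
      have hs := hstep ((k : ℝ) * D) D ht0 hDpos hDΔ htT
      have hcast : ((k + 1 : ℕ) : ℝ) * D = (k : ℝ) * D + D := by push_cast; ring
      rw [hcast]
      refine hs.trans ?_
      calc ENNReal.ofReal (Real.exp (a * D)) * ∫⁻ z, ENNReal.ofReal (Real.exp (M (k * D) z)) ∂μ
          ≤ ENNReal.ofReal (Real.exp (a * D)) * ENNReal.ofReal (Real.exp (a * D * k)) := by
            gcongr
            exact ih hk'
        _ = ENNReal.ofReal (Real.exp (a * D * ((k + 1 : ℕ) : ℝ))) := by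
            rw [← ENNReal.ofReal_mul (Real.exp_pos _).le, ← Real.exp_add]
            congr 1
            push_cast
            ring_nf
  have hfin := key m le_rfl
  rw [hmD] at hfin
  refine hfin.trans (le_of_eq ?_)
  congr 2
  calc a * D * m = a * (m * D) := by ring
    _ = a * T := by rw [hmD]

variable {σ : ℝ} {n : ℕ}

/-- Threading the thresholds: the final exponent is `≤ δ L³`. -/
theorem final_exponent_le {C b B T L δ θ η : ℝ} (hC : 0 < C) (hδ : 0 < δ) (hT1 : 1 ≤ T) (hL1 : 1 ≤ L)
    (hTδ : 16 * C * (b + 1) / δ ≤ T) (hLB : 2 * B * T / δ ≤ L) (hθ : θ ^ 2 ≤ 4 / T ^ 2)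
    (hηT : η * T ≤ δ / 4) :
    4 * C * b * L ^ 3 / T + (C * θ ^ 2 * L ^ 3 + η * L ^ 3 + B * L ^ 2) * T ≤ δ * L ^ 3 := by
  have hTpos : 0 < T := one_pos.trans_le hT1
  have hLpos : 0 < L := one_pos.trans_le hL1
  have hL3 : 0 < L ^ 3 := pow_pos hLpos 3
  have h1 : 16 * C * (b + 1) ≤ T * δ := (div_le_iff₀ hδ).1 hTδ
  have h2 : 2 * B * T ≤ L * δ := (div_le_iff₀ hδ).1 hLB
  -- the θ²-term
  have hθT : C * θ ^ 2 * L ^ 3 * T ≤ 4 * C * L ^ 3 / T := by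
    rw [le_div_iff₀ hTpos]
    have : θ ^ 2 * T ^ 2 ≤ 4 := by
      have := (le_div_iff₀ (pow_pos hTpos 2)).1 hθ
      linarith
    nlinarith [mul_nonneg hC.le hL3.le]
  -- the two `1/T` terms
  have hmain : 4 * C * b * L ^ 3 / T + 4 * C * L ^ 3 / T ≤ δ / 4 * L ^ 3 := by
    rw [← add_div, div_le_iff₀ hTpos]
    nlinarith [mul_nonneg hC.le hL3.le]
  -- the forecast slack
  have hηterm : η * L ^ 3 * T ≤ δ / 4 * L ^ 3 := by nlinarith
  -- the boundary term
  have hbdry : B * L ^ 2 * T ≤ δ / 2 * L ^ 3 := by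
    have hL2 : 0 ≤ L ^ 2 := sq_nonneg L
    nlinarith
  nlinarith

/-- **The crux from the stubs** (the card's `tiltStability_imp`, kernel-checked). Order of choices (no loop):
`σ₀` = min of the stubs' thresholds and `3/16` (probability measure); `κ` from S4 (fed S2, S3); given `g`: `w`
from S1 (`b = C₀κ`), `C, Δ, T₀` from S4; given `δ`: `T = max(T₀, 16C(b+1)/δ)`, `η = δ/(4T)`; `B, R₀` from S4;
given `R`: `L₀ = max(L₀(S4), 1, 2BT/δ)`; given `L, n, Ψ`: `ν` from S4; given `c`: `θ = −2c/T`, identity +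
coboundary pointwise, slab iteration, thresholds. -/
theorem CellForecastPressureDecay_of : CellForecastPressureDecay := by
  obtain ⟨C₀, hC₀, hS1⟩ := stub_poissonCorrector
  obtain ⟨σ₂, hσ₂, hS2⟩ := kinematicRates_of_stubs
  obtain ⟨σ₃, hσ₃, hS3⟩ := stub_windowL2Rate
  obtain ⟨σ₄, hσ₄, hS4⟩ := stub_tiltStability
  refine ⟨min (min σ₂ σ₃) (min σ₄ (3 / 16)), by positivity, fun σ hσ hσlt => ?_⟩
  have h2 : σ < σ₂ := hσlt.trans_le ((min_le_left _ _).trans (min_le_left _ _))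
  have h3 : σ < σ₃ := hσlt.trans_le ((min_le_left _ _).trans (min_le_right _ _))
  have h4 : σ < σ₄ := hσlt.trans_le ((min_le_right _ _).trans (min_le_left _ _))
  have h316 : σ ≤ 3 / 16 := (hσlt.trans_le ((min_le_right _ _).trans (min_le_right _ _))).le
  have hK : KinematicRates σ := hS2 σ hσ h2
  have hL2 : WindowL2Rate σ := hS3 σ hσ h3 hK
  obtain ⟨κ, hκ, hTS⟩ := hS4 σ hσ h4 hK hL2
  refine ⟨κ, hκ, fun g hgc hgκ horth δ hδ => ?_⟩
  -- the Poisson corrector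
  obtain ⟨w, hwc, hwb, hLw⟩ := hS1 g κ hgc hgκ horth
  set b : ℝ := C₀ * κ with hbdef
  have hb : 0 ≤ b := by positivity
  obtain ⟨C, hC, Δ, hΔ, hΔ1, T₀, hT₀, hT⟩ := hTS g hgc hgκ horth w b hwc hwb hLw
  -- the horizon
  set T : ℝ := max T₀ (16 * C * (b + 1) / δ) with hTdef
  have hTT₀ : T₀ ≤ T := le_max_left _ _
  have hT1 : 1 ≤ T := hT₀.trans hTT₀
  have hTpos : 0 < T := one_pos.trans_le hT1
  have hTδ : 16 * C * (b + 1) / δ ≤ T := le_max_right _ _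
  -- the forecast slack `η L³` with `η T = δ/4`
  set η : ℝ := δ / (4 * T) with hηdef
  have hη : 0 < η := by positivity
  have hηT : η * T ≤ δ / 4 := by
    rw [hηdef]; field_simp; rfl
  obtain ⟨B, hB, R₀, hR₀, hR⟩ := hT T hTT₀ η hη
  refine ⟨T, hTpos, R₀, hR₀, fun R hRR => ?_⟩
  obtain ⟨L₁, hL₁, hL⟩ := hR R hRR
  refine ⟨max L₁ (max 1 (2 * B * T / δ)), lt_max_of_lt_left hL₁, fun L hLL n hn Ψ c hc => ?_⟩
  have hLL₁ : L₁ ≤ L := (le_max_left _ _).trans hLL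
  have hL1 : 1 ≤ L := ((le_max_left _ _).trans (le_max_right _ _)).trans hLL
  have hLB : 2 * B * T / δ ≤ L := ((le_max_right _ _).trans (le_max_right _ _)).trans hLL
  obtain ⟨ν, hν, hnν, hslab⟩ := hL L hLL₁ n hn Ψ
  -- the cell law is a probability measure (landed Disproof § 1)
  haveI : IsProbabilityMeasure (cellLaw σ L n Ψ) := isProbabilityMeasure_cellLaw h316 hL1 hn (Ψ n)
  -- the tilt
  set θ : ℝ := -(2 * c / T) with hθdef
  have hcabs : |c| ≤ 1 := hc
  have hθabs : |θ| ≤ 2 / T := by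
    rw [hθdef, abs_neg, abs_div, abs_mul, abs_of_pos (by norm_num : (0 : ℝ) < 2), abs_of_pos hTpos]
    gcongr
    linarith
  have hθsq : θ ^ 2 ≤ 4 / T ^ 2 := by
    have h1 : θ ^ 2 = |θ| ^ 2 := (sq_abs θ).symm
    rw [h1, show (4 : ℝ) / T ^ 2 = (2 / T) ^ 2 by ring]
    exact pow_le_pow_left₀ (abs_nonneg θ) hθabs 2
  -- slab iteration for `θ M`
  have hiter : ∫⁻ z, ENNReal.ofReal (Real.exp (θ * compensated w ν g Ψ R T z)) ∂(cellLaw σ L n Ψ) ≤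
      ENNReal.ofReal (Real.exp ((C * θ ^ 2 * L ^ 3 + η * L ^ 3 + B * L ^ 2) * T)) :=
    iterate_slabs (cellLaw σ L n Ψ) (fun t z => θ * compensated w ν g Ψ R t z)
      (fun z => by simp [compensated_zero]) hΔ hTpos
      (fun t Δ' ht hΔ' hΔ'Δ htT => hslab θ hθabs t Δ' ht hΔ' hΔ'Δ htT)
  -- pointwise: identity + coboundary
  have hnν : (n : ℝ) / ν ≤ C * L ^ 3 := by
    rw [div_le_iff₀ hν]
    calc (n : ℝ) ≤ C * ν * L ^ 3 := hnν
      _ = C * L ^ 3 * ν := by ring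
  have hpt : ∀ z : Cell n,
      ENNReal.ofReal (Real.exp (2 * c * ∑ i : Fin n, T⁻¹ * ∫ t in (0 : ℝ)..T,
          g (localClusterState Ψ R t z i).2)) ≤
        ENNReal.ofReal (Real.exp (4 * C * b * L ^ 3 / T)) *
          ENNReal.ofReal (Real.exp (θ * compensated w ν g Ψ R T z)) := by
    intro z
    rw [← ENNReal.ofReal_mul (Real.exp_pos _).le, ← Real.exp_add]
    refine ENNReal.ofReal_le_ofReal (Real.exp_le_exp.2 ?_)
    have hid := crux_exponent_eq w ν g Ψ R hTpos.ne' c z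
    have hco := abs_coboundary_le w hwb hν Ψ R T z
    have hcob : (2 * c / T) * (ν⁻¹ * ∑ i, (w (fvel Ψ R T z i) - w (fvel Ψ R 0 z i))) ≤
        4 * C * b * L ^ 3 / T := by
      have h1 : |(2 * c / T) * (ν⁻¹ * ∑ i, (w (fvel Ψ R T z i) - w (fvel Ψ R 0 z i)))| ≤
          (2 / T) * (ν⁻¹ * (2 * b * n)) := by
        rw [abs_mul]
        refine mul_le_mul ?_ hco (abs_nonneg _) (by positivity)
        rw [abs_div, abs_mul, abs_of_pos (by norm_num : (0 : ℝ) < 2), abs_of_pos hTpos]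
        exact div_le_div_of_nonneg_right (by linarith) hTpos.le
      have h2 : (2 / T) * (ν⁻¹ * (2 * b * n)) ≤ 4 * C * b * L ^ 3 / T := by
        have h3 : ν⁻¹ * (2 * b * n) = 2 * b * (n / ν) := by
          field_simp
        rw [h3, div_mul_eq_mul_div, div_le_div_iff_of_pos_right hTpos]
        nlinarith [mul_le_mul_of_nonneg_left hnν (by positivity : (0 : ℝ) ≤ 2 * b)]
      exact (le_abs_self _).trans (h1.trans h2)
    have hw : (2 * c * ∑ i : Fin n, T⁻¹ * ∫ t in (0 : ℝ)..T, g (localClusterState Ψ R t z i).2) =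
        2 * c * ∑ i, T⁻¹ * windowInt g Ψ R T z i := rfl
    rw [hw, hid]
    linarith
  -- integrate and thread the thresholds
  rw [← cellLaw_eq]
  calc ∫⁻ z, ENNReal.ofReal (Real.exp (2 * c * ∑ i : Fin n, T⁻¹ * ∫ t in (0 : ℝ)..T,
          g (localClusterState Ψ R t z i).2)) ∂(cellLaw σ L n Ψ)
      ≤ ∫⁻ z, ENNReal.ofReal (Real.exp (4 * C * b * L ^ 3 / T)) *
          ENNReal.ofReal (Real.exp (θ * compensated w ν g Ψ R T z)) ∂(cellLaw σ L n Ψ) :=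
        lintegral_mono hpt
    _ = ENNReal.ofReal (Real.exp (4 * C * b * L ^ 3 / T)) *
          ∫⁻ z, ENNReal.ofReal (Real.exp (θ * compensated w ν g Ψ R T z)) ∂(cellLaw σ L n Ψ) :=
        lintegral_const_mul' _ _ ENNReal.ofReal_ne_top
    _ ≤ ENNReal.ofReal (Real.exp (4 * C * b * L ^ 3 / T)) *
          ENNReal.ofReal (Real.exp ((C * θ ^ 2 * L ^ 3 + η * L ^ 3 + B * L ^ 2) * T)) := by
        gcongr
    _ = ENNReal.ofReal (Real.exp (4 * C * b * L ^ 3 / T +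
          (C * θ ^ 2 * L ^ 3 + η * L ^ 3 + B * L ^ 2) * T)) := by
        rw [← ENNReal.ofReal_mul (Real.exp_pos _).le, ← Real.exp_add]
    _ ≤ ENNReal.ofReal (Real.exp (δ * L ^ 3)) :=
        ENNReal.ofReal_le_ofReal (Real.exp_le_exp.2
          (final_exponent_le hC hδ hT1 hL1 hTδ hLB hθsq hηT))

end Composition

end Summit.AtomisticToContinuum.HydrodynamicLimit.Cruxes.CellForecastPressureDecay.EnskogCompensatorMartingale

end
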